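import Literature.MathematicalPhysics.QuantumFieldTheory.Balaban1983to89.LatticeWordStokes
import Literature.MathematicalPhysics.QuantumFieldTheory.Balaban1983to89.UnitaryModel
import Literature.MathematicalPhysics.QuantumFieldTheory.Balaban1983to89.B10Eq27TorusAxialLog
import Summits.QuantumFields.YangMills.Theorems.UnitScaleTiltAvgCurvGradRect
import HarnessLib

/-!
# Route `UnitScaleTilt`, crux K1 child «MinimiserStabilityRegPr» (stmt-QuantumFields-19200), stub `stub_avgCurvGrad` — helper A1:
# KINEMATICS FOR THE COVARIANT WORD GRADIENT — `SU(N)` read in `M_N(ℂ)`, rotations of closed words, the four-letter defect word, the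
# ladder word, and THE CONJUGATION LEMMA (transporting along a prefix commutes with the covariant gradient up to the ladder loop)

Cell `ym3-torus` ∕ fleet seat `ym-ust-19200-p1` (HUMAN RULING D-0037, YM ladder rung R3).  Registered stub `stub_avgCurvGrad` of the
layer-4 v3b birth of «MinimiserStabilityRegPr» (located gap G-K1a-3a′, schema `T3AvgDivergenceSplit.AvgCurvGradAt`: first-order regularity
of the one-step (0.4) block average).  This file and its sequel `UnitScaleTiltAvgCurvGradWordStokes` are the GRADIENT twin of the tree's
crude non-abelian lattice Stokes bound `LatticeWordStokes.dist1_holAt_le` (zeroth order: `|𝒰_x(w) − 1| ≤ (|w|²/4)·a`).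

NOTATION.  `𝒰_x(w) = holAt U (walk x w)`; `β_x = U⟨x − e_ν, x⟩`; the BACKWARD COVARIANT WORD GRADIENT in direction `ν` is the matrix
`∇_ν𝒰_x(w) := β_x⁻¹·𝒰_{x−e_ν}(w)·β_x − 𝒰_x(w)` ([Balaban1985RegularSpaces] (1.1) applied to the function `x ↦ 𝒰_x(w)`; for the plaquette
word it is the covariant derivative of the plaquette field, `B10Eq68TorusRegularity.covDerivT` at `η = 1`).

* §0 `SU(N)` read in `M_N(ℂ)`: `‖g₁g₂ − h₁h₂‖ ≤ ‖g₁ − h₁‖ + ‖g₂ − h₂‖`, `‖g⁻¹ − h⁻¹‖ = ‖g − h‖`, conjugation is an isometry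
  (`‖uXu⁻¹ − X‖ ≤ 2|u − 1|·|X − 1|` is the sibling helper's `UnitScaleTiltAvgCurvGradRect.norm_conj_sub_self_le`).
* §1 words: translating the base translates the end; ROTATING a closed word conjugates its holonomy by the prefix transporter; the
  commutator defect of two letters is the holonomy of the four-letter word `m₁ m₂ m̄₁ m̄₂`; the LADDER word `Ā (−ν) A (+ν)`; plaquette words
  of either orientation are within `a` of `1`.
* §2 **THE CONJUGATION LEMMA** `norm_transport_conj_sub_le`: transporting by a prefix `A` commutes with `∇_ν` up to the ladder loop:
  `‖β_x⁻¹·𝒰_{x⁻}(A) X₁ 𝒰_{x⁻}(A)⁻¹·β_x − 𝒰_x(A) X₀ 𝒰_x(A)⁻¹‖ ≤ ‖β_y⁻¹ X₁ β_y − X₀‖ + 2·(|A|+1)²a·|X₁ − 1|` (`y` = end of `A`).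

Elementary lattice gauge kinematics (our own statements, tagged [folklore] / cited to the printed identities they instantiate).

References: T. Bałaban, CMP 98 (1985) 17–51 [Balaban1985Averaging] ((9) p.19, (19)–(20) p.21); CMP 99 (1985) 75–102
[Balaban1985RegularSpaces] ((1.1) p.76, (1.11) p.77).
-/

noncomputable section

open scoped Matrix.Norms.L2Operator

namespace Summit.QuantumFields.YangMills.Theorems.AvgCurvGrad

open Literature.MathematicalPhysics.QuantumFieldTheory.Balaban1983to89
open T4Continuum LatticeWordStokes
open B7Prop1Explicit (plaqWord)
open B10Eq27TorusAxialLog (holT_eq_holAt holT_plaqWord_eq_plaqHol holT_plaqWord_swap)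

/-! ## §0 `SU(N)` read in `M_N(ℂ)` -/

section Matrices

variable {n : Type*} [Fintype n] [DecidableEq n]

/-- A special unitary matrix has operator norm `1`. [folklore] -/
theorem norm_coe_su [Nonempty n] (g : Matrix.specialUnitaryGroup n ℂ) : ‖(g : Matrix n n ℂ)‖ = 1 :=
  UnitaryModel.norm_of_mem_unitaryGroup (Matrix.specialUnitaryGroup_le_unitaryGroup g.2)

/-- The inverse is the adjoint. [folklore] -/
private theorem coe_inv_su (g : Matrix.specialUnitaryGroup n ℂ) :
    ((g⁻¹ : Matrix.specialUnitaryGroup n ℂ) : Matrix n n ℂ) = star (g : Matrix n n ℂ) := rfl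

variable [Nonempty n]

omit [Nonempty n] in
/-- Conjugation is an isometry: `‖gYg⁻¹ − gY′g⁻¹‖ = ‖Y − Y′‖`. [cite: Balaban1985Averaging, (19)-(20) p.21] -/
theorem norm_coe_conj_sub_conj (g Y Y' : Matrix.specialUnitaryGroup n ℂ) :
    ‖((g * Y * g⁻¹ : Matrix.specialUnitaryGroup n ℂ) : Matrix n n ℂ) - ((g * Y' * g⁻¹ : Matrix.specialUnitaryGroup n ℂ) : Matrix n n ℂ)‖ =
      ‖(Y : Matrix n n ℂ) - (Y' : Matrix n n ℂ)‖ := by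
  have hg : (g : Matrix n n ℂ) ∈ Matrix.unitaryGroup n ℂ := g.2.1
  have hg' : ((g⁻¹ : Matrix.specialUnitaryGroup n ℂ) : Matrix n n ℂ) ∈ Matrix.unitaryGroup n ℂ := (g⁻¹).2.1
  simp only [Submonoid.coe_mul]
  rw [← sub_mul, ← mul_sub, CStarRing.norm_mul_mem_unitary _ hg', CStarRing.norm_mem_unitary_mul _ hg]

/-- `‖g₁g₂ − h₁h₂‖ ≤ ‖g₁ − h₁‖ + ‖g₂ − h₂‖` for special unitaries (`g₁g₂ − h₁h₂ = (g₁ − h₁)g₂ + h₁(g₂ − h₂)`, norms `1`).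
[cite: Balaban1985Averaging, (19)-(20) p.21] -/
theorem norm_coe_mul_sub_mul_le (g₁ g₂ h₁ h₂ : Matrix.specialUnitaryGroup n ℂ) :
    ‖((g₁ * g₂ : Matrix.specialUnitaryGroup n ℂ) : Matrix n n ℂ) - ((h₁ * h₂ : Matrix.specialUnitaryGroup n ℂ) : Matrix n n ℂ)‖ ≤
      ‖(g₁ : Matrix n n ℂ) - (h₁ : Matrix n n ℂ)‖ + ‖(g₂ : Matrix n n ℂ) - (h₂ : Matrix n n ℂ)‖ := by
  simp only [Submonoid.coe_mul]
  have hid : (g₁ : Matrix n n ℂ) * (g₂ : Matrix n n ℂ) - (h₁ : Matrix n n ℂ) * (h₂ : Matrix n n ℂ) =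
      ((g₁ : Matrix n n ℂ) - (h₁ : Matrix n n ℂ)) * (g₂ : Matrix n n ℂ) + (h₁ : Matrix n n ℂ) * ((g₂ : Matrix n n ℂ) - (h₂ : Matrix n n ℂ)) := by
    noncomm_ring
  rw [hid]
  refine (norm_add_le _ _).trans (add_le_add ?_ ?_)
  · exact (norm_mul_le _ _).trans (by rw [norm_coe_su, mul_one])
  · exact (norm_mul_le _ _).trans (by rw [norm_coe_su, one_mul])

omit [Nonempty n] in
/-- `‖g⁻¹ − h⁻¹‖ = ‖g − h‖` for special unitaries (`g⁻¹ − h⁻¹ = (g − h)*`). [cite: Balaban1985Averaging, (19)-(20) p.21] -/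
theorem norm_coe_inv_sub_inv (g h : Matrix.specialUnitaryGroup n ℂ) :
    ‖((g⁻¹ : Matrix.specialUnitaryGroup n ℂ) : Matrix n n ℂ) - ((h⁻¹ : Matrix.specialUnitaryGroup n ℂ) : Matrix n n ℂ)‖ =
      ‖(g : Matrix n n ℂ) - (h : Matrix n n ℂ)‖ := by
  rw [coe_inv_su, coe_inv_su, ← star_sub, norm_star]

omit [Nonempty n] in
/-- The triangle inequality through an intermediate matrix: `‖A − C‖ ≤ ‖A − B‖ + ‖B − C‖`. [folklore] -/
theorem norm_sub_le_of_mid (A B C : Matrix n n ℂ) : ‖A - C‖ ≤ ‖A - B‖ + ‖B - C‖ := by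
  have : A - C = (A - B) + (B - C) := by abel
  rw [this]
  exact norm_add_le _ _

end Matrices

/-! ## §1 Words: translated bases, rotations, the four-letter defect word, the ladder word -/

section Words

variable {P : Params} {j : ℕ} {G : Type*} [GaugeGroup G] (U : GaugeField P j G)

omit [GaugeGroup G] in
/-- Translating the base of a walk by `−e_ν` translates its end by `−e_ν`. [folklore] -/
theorem walkEnd_unshift (x : Site P j) (w : List (Letter P.d)) (ν : Fin P.d) :
    walkEnd (x.unshift ν) w = (walkEnd x w).unshift ν := by
  funext i
  rw [walkEnd_apply, Site.unshift_apply, Site.unshift_apply, walkEnd_apply, walkEnd_apply]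
  split_ifs with h
  · subst h; ring
  · rfl

omit [GaugeGroup G] in
/-- A word with zero net displacement in every direction returns to its base. [folklore] -/
theorem walkEnd_eq_self_of_closed {x : Site P j} {w : List (Letter P.d)} (hw : ∀ μ, netDisp w μ = 0) : walkEnd x w = x :=
  walkEnd_eq_self_of_netDisp fun μ => by rw [hw μ, Int.cast_zero]

/-- **ROTATING A CLOSED WORD CONJUGATES ITS HOLONOMY** by the transport along the moved prefix:
`𝒰_x(AB) = 𝒰_x(A)·𝒰_y(BA)·𝒰_x(A)⁻¹`, `y` the end of `A` (multiplicativity of the transport [Balaban1985Averaging] (9)).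
[cite: Balaban1985Averaging, (9) p.19] -/
theorem holAt_walk_rotate (x : Site P j) (A B : List (Letter P.d)) (hAB : ∀ μ, netDisp (A ++ B) μ = 0) :
    holAt U (walk x (A ++ B)) =
      holAt U (walk x A) * holAt U (walk (walkEnd x A) (B ++ A)) * (holAt U (walk x A))⁻¹ := by
  have hend : walkEnd (walkEnd x A) B = x := by rw [← walkEnd_append]; exact walkEnd_eq_self_of_closed hAB
  rw [walk_append, holAt_append, walk_append, holAt_append, hend]
  group

omit [GaugeGroup G] in
/-- Two-letter words that are permutations of each other end at the same site. [folklore] -/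
private theorem walkEnd_pair_comm (y : Site P j) (m₁ m₂ : Letter P.d) : walkEnd y [m₁, m₂] = walkEnd y [m₂, m₁] := by
  funext ν
  rw [walkEnd_apply, walkEnd_apply, netDisp_cons, netDisp_cons, netDisp_cons, netDisp_cons]
  congr 1
  push_cast
  ring

/-- **THE COMMUTATOR DEFECT OF TWO LETTERS IS THE HOLONOMY OF THE FOUR-LETTER WORD `m₁ m₂ m̄₁ m̄₂`** (a plaquette word read from
one of its corners in one of its orientations, or a trivial word if the letters are parallel). [cite: Balaban1985Averaging, (9) p.19] -/
theorem swapDefect_eq_holAt_four (y : Site P j) (m₁ m₂ : Letter P.d) :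
    holAt U (walk y [m₁, m₂]) * (holAt U (walk y [m₂, m₁]))⁻¹ = holAt U (walk y [m₁, m₂, m₁.flip, m₂.flip]) := by
  have hw : [m₁, m₂, m₁.flip, m₂.flip] = [m₁, m₂] ++ wordRev [m₂, m₁] := by simp [wordRev]
  rw [hw, walk_append, holAt_append, walkEnd_pair_comm, holAt_walk_wordRev]

omit [GaugeGroup G] in
/-- The four-letter defect word is closed. [folklore] -/
theorem netDisp_four (m₁ m₂ : Letter P.d) (μ : Fin P.d) : netDisp [m₁, m₂, m₁.flip, m₂.flip] μ = 0 := by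
  obtain ⟨κ, s⟩ := m₁
  obtain ⟨κ', t⟩ := m₂
  simp only [netDisp, Letter.flip, List.map_cons, List.map_nil, List.sum_cons, List.sum_nil]
  by_cases h₁ : κ = μ <;> by_cases h₂ : κ' = μ <;> cases s <;> cases t <;> simp [h₁, h₂]

/-- **THE LADDER WORD** `Ā (−ν) A (+ν)` around a prefix `A`, read from the end `y` of `A`: its holonomy is
`𝒰_x(A)⁻¹·U(x−e_ν,x)⁻¹·𝒰_{x−e_ν}(A)·U(y−e_ν,y)`. [cite: Balaban1985Averaging, (9) p.19] -/
theorem holAt_ladder (x : Site P j) (A : List (Letter P.d)) (ν : Fin P.d) :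
    holAt U (walk (walkEnd x A) (wordRev A ++ (ν, false) :: (A ++ [(ν, true)]))) =
      (holAt U (walk x A))⁻¹ * (U ⟨x.unshift ν, ν⟩)⁻¹ * holAt U (walk (x.unshift ν) A) *
        U ⟨(walkEnd x A).unshift ν, ν⟩ := by
  rw [walk_append, holAt_append, holAt_walk_wordRev, walkEnd_walkEnd_wordRev]
  simp only [walk]
  rw [holAt_cons, walk_append, holAt_append, walkEnd_unshift]
  simp only [walk, holAt_cons, holAt_nil, Bool.false_eq_true, if_false, if_true, mul_one, mul_assoc]

omit [GaugeGroup G] in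
/-- The ladder word is closed. [folklore] -/
theorem netDisp_ladder (A : List (Letter P.d)) (ν μ : Fin P.d) :
    netDisp (wordRev A ++ (ν, false) :: (A ++ [(ν, true)])) μ = 0 := by
  rw [T4ReflectionCone.netDisp_append, netDisp_cons, T4ReflectionCone.netDisp_append, netDisp_wordRev, netDisp_cons]
  simp only [netDisp, List.map_nil, List.sum_nil, Bool.false_eq_true, if_false, if_true]
  split_ifs <;> ring

omit [GaugeGroup G] in
/-- The ladder word has length `2|A| + 2`. [folklore] -/
theorem length_ladder (A : List (Letter P.d)) (ν : Fin P.d) :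
    (wordRev A ++ (ν, false) :: (A ++ [(ν, true)])).length = 2 * A.length + 2 := by
  simp only [List.length_append, List.length_cons, wordRev, List.length_reverse, List.length_map, List.length_nil]
  ring

/-- **Every plaquette word (two distinct axes, either order) has holonomy within `a` of `1`** under `PlaqSmall a U` (the reversed
orientation is the inverse plaquette variable). [cite: Balaban1985Averaging, (9) p.19 and (19)-(20) p.21] -/
theorem dist1_holAt_plaqWord_lt {a : ℝ} (hU : PlaqSmall a U) (z : Site P j) {κ κ' : Fin P.d} (h : κ ≠ κ') :
    dist1 (holAt U (walk z (plaqWord κ κ'))) < a := by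
  rcases lt_or_gt_of_ne h with hlt | hgt
  · rw [← holT_eq_holAt, holT_plaqWord_eq_plaqHol U ⟨z, κ, κ', hlt⟩]; exact hU _
  · rw [← holT_eq_holAt, holT_plaqWord_swap, GaugeGroup.dist1_inv, holT_plaqWord_eq_plaqHol U ⟨z, κ', κ, hgt⟩]; exact hU _

end Words

/-! ## §2 The conjugation lemma: transporting along a prefix commutes with `∇_ν` up to the ladder loop -/

section Conj

variable {n : Type*} [Fintype n] [DecidableEq n] [Nonempty n] {P : Params} {j : ℕ}
  (U : GaugeField P j (Matrix.specialUnitaryGroup n ℂ))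

/-- **THE CONJUGATION LEMMA.**  For a prefix `A` from `x` to `y` and elements `X₀` («at `y`») and `X₁` («at `y − e_ν`»):
`‖β_x⁻¹·(𝒰_{x⁻}(A) X₁ 𝒰_{x⁻}(A)⁻¹)·β_x − 𝒰_x(A) X₀ 𝒰_x(A)⁻¹‖ ≤ ‖β_y⁻¹ X₁ β_y − X₀‖ + 2·((|A|+1)²a)·|X₁ − 1|`
(`β_z = U(z−e_ν, z)`, `x⁻ = x − e_ν`): the two transports from `y − e_ν` to `x` differ by the LADDER LOOP `Ā(−ν)A(+ν)`, a closed word of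
length `2|A|+2`, within `(|A|+1)²a` of `1` by the crude Stokes bound (`LatticeWordStokes.dist1_holAt_le`), and conjugating the small `X₁` by it
costs `2·|ladder − 1|·|X₁ − 1|` (§0). [cite: Balaban1985RegularSpaces, (1.11) p.77] -/
theorem norm_transport_conj_sub_le {a : ℝ} (ha : 0 ≤ a) (hU : PlaqSmall a U) (x : Site P j) (A : List (Letter P.d))
    (ν : Fin P.d) (X₀ X₁ : Matrix.specialUnitaryGroup n ℂ) :
    ‖(((U ⟨x.unshift ν, ν⟩)⁻¹ * (holAt U (walk (x.unshift ν) A) * X₁ * (holAt U (walk (x.unshift ν) A))⁻¹) *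
          U ⟨x.unshift ν, ν⟩ : Matrix.specialUnitaryGroup n ℂ) : Matrix n n ℂ) -
        ((holAt U (walk x A) * X₀ * (holAt U (walk x A))⁻¹ : Matrix.specialUnitaryGroup n ℂ) : Matrix n n ℂ)‖ ≤
      ‖(((U ⟨(walkEnd x A).unshift ν, ν⟩)⁻¹ * X₁ * U ⟨(walkEnd x A).unshift ν, ν⟩ : Matrix.specialUnitaryGroup n ℂ) :
            Matrix n n ℂ) - (X₀ : Matrix n n ℂ)‖ +
        2 * (((A.length : ℝ) + 1) ^ 2 * a) * dist1 X₁ := by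
  set hA := holAt U (walk x A) with hA_def
  set hA' := holAt U (walk (x.unshift ν) A) with hA'_def
  set β := U ⟨x.unshift ν, ν⟩ with hβ
  set γ := U ⟨(walkEnd x A).unshift ν, ν⟩ with hγ
  set ℓ := hA⁻¹ * β⁻¹ * hA' * γ with hℓ
  set V := γ⁻¹ * X₁ * γ with hV
  have hid : β⁻¹ * (hA' * X₁ * hA'⁻¹) * β = hA * (ℓ * V * ℓ⁻¹) * hA⁻¹ := by
    simp only [hℓ, hV]; group
  rw [hid, norm_coe_conj_sub_conj]
  have hℓw : ℓ = holAt U (walk (walkEnd x A) (wordRev A ++ (ν, false) :: (A ++ [(ν, true)]))) := by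
    rw [holAt_ladder]
  have hℓ1 : dist1 ℓ ≤ ((A.length : ℝ) + 1) ^ 2 * a := by
    rw [hℓw]
    refine (dist1_holAt_le U ha hU _ (netDisp_ladder A ν) _).trans (le_of_eq ?_)
    rw [length_ladder]; push_cast; ring
  have hV1 : dist1 V = dist1 X₁ := by
    rw [hV, show γ⁻¹ * X₁ * γ = γ⁻¹ * X₁ * γ⁻¹⁻¹ by rw [inv_inv], GaugeGroup.dist1_conj]
  have h2 : 2 * dist1 ℓ * dist1 V ≤ 2 * (((A.length : ℝ) + 1) ^ 2 * a) * dist1 X₁ := by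
    rw [hV1]
    exact mul_le_mul_of_nonneg_right (mul_le_mul_of_nonneg_left hℓ1 zero_le_two) (GaugeGroup.dist1_nonneg _)
  calc ‖((ℓ * V * ℓ⁻¹ : Matrix.specialUnitaryGroup n ℂ) : Matrix n n ℂ) - (X₀ : Matrix n n ℂ)‖
      ≤ ‖((ℓ * V * ℓ⁻¹ : Matrix.specialUnitaryGroup n ℂ) : Matrix n n ℂ) - (V : Matrix n n ℂ)‖ +
          ‖(V : Matrix n n ℂ) - (X₀ : Matrix n n ℂ)‖ := norm_sub_le_of_mid _ _ _
    _ ≤ 2 * dist1 ℓ * dist1 V + ‖(V : Matrix n n ℂ) - (X₀ : Matrix n n ℂ)‖ := add_le_add (norm_conj_sub_self_le ℓ V) le_rfl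
    _ ≤ _ := by rw [add_comm]; exact add_le_add le_rfl h2

end Conj

end Summit.QuantumFields.YangMills.Theorems.AvgCurvGrad

end
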